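import Summits.ValiantsHypothesis.ValiantsHypothesis.Theorems.BarrierLeverAnchoredDoorHitsLowerPairsStarTwoCentreDesign

/-!
# Route BarrierLever — support item `AnchoredDoorHitsLowerPairs` (stmt-ValiantsHypothesis-22510), line `anchored_peeling`:
# TWO-CENTRE 0/1 DESIGNS, II: block triangularity and the design theorem

Helper file (`--supports stmt-ValiantsHypothesis-22510`; val-np-p1 g34), continuation of …StarTwoCentreDesign. Closes NO item; nothing
here bears on crux 14610 or on `VP ≠ VNP`, which is NOT proved.

**THEOREM (`TCDesign.starDet_ne_zero_of_design`).** Let `D` be a two-centre design of an injective pair `(u, w)` (…StarTwoCentreDesign: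
up-closed excess sets `𝓐*`, `𝓢*`, seatings `α`, `β`, pairing `γ`). If the `ε × ε` integer DESIGN MATRIX
`B[p, q] = twoTop ḡ_D d̄_D (u p) (w (γ q))` (`p, q ∈ 𝓐*`) has `det B ≠ 0`, then some complex weights make the star-forest block of
`(u, w)` nonsingular. PROOF: after the column permutation `κ` of the design the two-centre matrix with the 0/1 design weights is
BLOCK-TRIANGULAR for the classes (big rows `∉ 𝓐*` ↔ column vertices) < (`𝓐*` ↔ `𝓢*`) < (row vertices ↔ big columns `∉ 𝓢*`) < (`∅ ↔ ∅`)
(`blockTriangular_N`; the vanishing above the diagonal is up-closedness), with diagonal blocks the inclusion matrix of the big row faces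
outside `𝓐*` (det 1), `B`, the transposed inclusion matrix of the big column faces outside `𝓢*` (det 1) and `(1)`
(`Matrix.BlockTriangular.det`, `ProductStateSums.det_inclusionMatrix`); then the two-centre principle `starDet_ne_zero_of_twoTop`.

ERRATUM TO …StarTwoCentre (val-np-p1 g34, kit j336933 + lab/simplex_t2.py). The node `Stmt.conjStarTwoCentre` («the two-centre matrix is
nonsingular on EVERY face-rich pair») is FALSE as stated: the two-centre matrix is a sum of blocks of ranks `≤ 1`, `n₁`, `n₂`, `n₁n₂`
(double stars factor through `X × Y`), `|I₂|`, `|J₂|`, so it is singular whenever `r > 1 + n₁ + n₂ + n₁n₂ + |I₂| + |J₂|` — e.g. for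
`u = w =` an enumeration of `2^{[7]}` (`r = 128 > 106`), a pair that is trivially star-good. The census behind the node (every pair on
`≤ 5+5` vertices; random pairs below the rank bound) stands; the valid replacement node for the door slot is `Stmt.conjStarLowerFaceRich`.
The two-centre device and the designs below are CERTIFICATES for moderately face-rich pairs, not a conjecture about all of them.
-/

set_option linter.dupNamespace false

namespace Summit.ValiantsHypothesis.ValiantsHypothesis.Theorems.BarrierLever.AnchoredPeeling

open Finset
open Summit.ValiantsHypothesis.ValiantsHypothesis.Theorems.BarrierLever.ProductStateSums (det_inclusionMatrix)

noncomputable section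

namespace StarDoor

namespace TCDesign

variable {h r : ℕ} {u w : Fin r → Finset (Fin h)} (D : TCDesign u w)

/-! ## 1. The permuted two-centre matrix of the design -/

/-- The two-centre matrix with the design weights over `K`, columns permuted by `κ`. -/
def N (K : Type*) [CommRing K] : Matrix (Fin r) (Fin r) K :=
  Matrix.of fun i j => twoTop (D.gD K) (D.dD K) (u i) (w (D.κ j))

/-- Entries of `N`. -/
theorem N_apply (K : Type*) [CommRing K] (i j : Fin r) : D.N K i j = twoTop (D.gD K) (D.dD K) (u i) (w (D.κ j)) := rfl

/-- **Block triangularity** (up-closedness of `𝓐*`, `𝓢*` kills the entries above the diagonal). -/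
theorem blockTriangular_N (K : Type*) [CommRing K] (hu : Function.Injective u) (hw : Function.Injective w) :
    (D.N K).BlockTriangular D.rt := by
  intro i j hlt
  rcases D.rt_cases i with ⟨hi, hri⟩ | ⟨_, _, hri⟩ | ⟨hi, hri⟩ | ⟨hi, hri⟩
  · -- `i ∈ 𝓐*`; then `rt j = 0`: a vertex column, entry `[u i ⊆ u (α (κ j))] = 0`
    rw [hri] at hlt
    have hcj : (w (D.κ j)).card = 1 := (D.ct_eq_zero_iff _).mp ((D.ct_κ j).trans (by omega))
    rw [N_apply, D.twoTop_big_vertex K hw (D.big_A i hi) ⟨D.κ j, hcj⟩, if_neg]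
    intro hsub
    exact (D.α ⟨D.κ j, hcj⟩).2.2 (D.up_A i hi _ hsub)
  · rw [hri] at hlt; exact absurd hlt (Nat.not_lt_zero _)
  · -- vertex row; `rt j ∈ {0, 1}`
    rw [hri] at hlt
    have hκ := D.ct_κ j
    rcases D.ct_cases (D.κ j) with ⟨hj, hcj⟩ | ⟨_, _, hcj⟩ | ⟨hj, hcj⟩ | ⟨_, hcj⟩
    · rw [N_apply, D.twoTop_vertex_big K hu ⟨i, hi⟩ (D.big_S _ hj), if_neg]
      intro hsub; exact (D.β ⟨i, hi⟩).2.2 (D.up_S _ hj _ hsub)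
    · omega
    · rw [N_apply, twoTop_card_one_card_one _ _ hi hj]
    · omega
  · -- empty row, nonempty column
    rw [hri] at hlt
    have hne : w (D.κ j) ≠ ∅ := fun h0 => by
      have h3 := (D.ct_eq_three_iff _).mpr (Finset.card_eq_zero.mpr h0)
      have := D.ct_κ j; omega
    rw [N_apply, Finset.card_eq_zero.mp hi, twoTop_empty_left, if_neg hne]

/-! ## 2. The diagonal blocks -/

/-- **Class 0:** the inclusion matrix of the big row faces outside `𝓐*`. -/
theorem toSquareBlock_zero (K : Type*) [CommRing K] (hw : Function.Injective w) :
    (D.N K).toSquareBlock D.rt 0 = Matrix.of fun p q : {a // D.rt a = 0} => if u p.1 ⊆ u q.1 then (1 : K) else 0 := by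
  ext ⟨p, hp⟩ ⟨q, hq⟩
  have hpb : 2 ≤ (u p).card := ((D.rt_eq_zero_iff p).mp hp).1
  have hq' := (D.rt_eq_zero_iff q).mp hq
  have hcq : (w (D.κ q)).card = 1 := (D.ct_eq_zero_iff _).mp ((D.ct_κ q).trans hq)
  have hsub : (⟨D.κ q, hcq⟩ : {j : Fin r // (w j).card = 1}) = D.α.symm ⟨q, hq'⟩ := Subtype.ext (D.κ_of_zero hq)
  simp only [Matrix.toSquareBlock_def, N_apply, Matrix.of_apply]
  rw [D.twoTop_big_vertex K hw hpb ⟨D.κ q, hcq⟩, hsub, Equiv.apply_symm_apply]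

/-- **Class 2:** the transposed inclusion matrix of the big column faces outside `𝓢*`. -/
theorem toSquareBlock_two (K : Type*) [CommRing K] (hu : Function.Injective u) :
    (D.N K).toSquareBlock D.rt 2 = (Matrix.of fun p q : {a // D.rt a = 2} =>
      if w (D.β ⟨p.1, (D.rt_eq_two_iff p.1).mp p.2⟩).1 ⊆ w (D.β ⟨q.1, (D.rt_eq_two_iff q.1).mp q.2⟩).1 then (1 : K) else 0).transpose := by
  ext ⟨p, hp⟩ ⟨q, hq⟩
  have hp1 : (u p).card = 1 := (D.rt_eq_two_iff p).mp hp
  have hκq : (D.κ q : Fin r) = (D.β ⟨q, (D.rt_eq_two_iff q).mp hq⟩ : Fin r) := D.κ_of_two hq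
  have hqb : 2 ≤ (w (D.κ q)).card := by rw [hκq]; exact (D.β ⟨q, _⟩).2.1
  simp only [Matrix.toSquareBlock_def, N_apply, Matrix.of_apply, Matrix.transpose_apply]
  rw [D.twoTop_vertex_big K hu ⟨p, hp1⟩ hqb, hκq]

/-- **Class 1:** the design matrix `B`, reindexed. -/
theorem toSquareBlock_one (K : Type*) [CommRing K] :
    (D.N K).toSquareBlock D.rt 1 = (Matrix.of fun p q : {i // i ∈ D.Astar} =>
      twoTop (D.gD K) (D.dD K) (u p.1) (w (D.γ q).1)).submatrix
        (Equiv.subtypeEquivRight fun i => D.rt_eq_one_iff i) (Equiv.subtypeEquivRight fun i => D.rt_eq_one_iff i) := by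
  ext ⟨p, hp⟩ ⟨q, hq⟩
  simp only [Matrix.toSquareBlock_def, N_apply, Matrix.of_apply, Matrix.submatrix_apply]
  rw [D.κ_of_one hq]
  rfl

/-- The class-3 fibre is a subsingleton (one empty row). -/
theorem subsingleton_fiber_three : Subsingleton {i : Fin r // D.rt i = 3} := by
  classical
  refine Fintype.card_le_one_iff_subsingleton.mp ?_
  rw [Fintype.card_subtype]
  have e1 : (univ.filter fun i => D.rt i = 3) = univ.filter fun i => (u i).card = 0 := by
    ext i; simp only [Finset.mem_filter, Finset.mem_univ, true_and]; exact D.rt_eq_three_iff i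
  rw [e1, D.hZr]

/-- The two-centre entries over `K` are the images of the integer ones. -/
theorem cast_twoTop (K : Type*) [CommRing K] (A S : Finset (Fin h)) :
    ((twoTop (D.gD ℤ) (D.dD ℤ) A S : ℤ) : K) = twoTop (D.gD K) (D.dD K) A S := by
  rw [show ((twoTop (D.gD ℤ) (D.dD ℤ) A S : ℤ) : K) = Int.castRingHom K (twoTop (D.gD ℤ) (D.dD ℤ) A S) from rfl,
    map_twoTop]
  congr 1
  · funext b e; exact D.cast_gD K b e
  · funext b e; exact D.cast_dD K b e

/-! ## 3. The design theorem -/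

/-- **THE DESIGN THEOREM.** A two-centre design with nonsingular integer design matrix makes the pair STAR-GOOD. -/
theorem starDet_ne_zero_of_design (hu : Function.Injective u) (hw : Function.Injective w)
    (hB : (Matrix.of fun p q : {i // i ∈ D.Astar} => twoTop (D.gD ℤ) (D.dD ℤ) (u p.1) (w (D.γ q).1)).det ≠ 0) :
    ∃ g d : Fin h → Fin h → ℂ, (Matrix.of fun i j : Fin r => starEntry g d (u i) (w j)).det ≠ 0 := by
  classical
  -- the permuted design matrix over ℂ is nonsingular, block by block
  have hblocks : ∀ k ∈ univ.image D.rt, ((D.N ℂ).toSquareBlock D.rt k).det ≠ 0 := by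
    intro k hk
    obtain ⟨i₁, _, hi₁⟩ := Finset.mem_image.mp hk
    have hk3 : k ≤ 3 := hi₁ ▸ D.rt_le_three i₁
    interval_cases k
    · rw [D.toSquareBlock_zero ℂ hw, det_inclusionMatrix (fun a : {a // D.rt a = 0} => u a.1)
        (fun a b hab => Subtype.ext (hu hab))]
      exact one_ne_zero
    · rw [D.toSquareBlock_one ℂ, Matrix.det_submatrix_equiv_self]
      have hcast : (Matrix.of fun p q : {i // i ∈ D.Astar} => twoTop (D.gD ℂ) (D.dD ℂ) (u p.1) (w (D.γ q).1)) =
          (Matrix.of fun p q : {i // i ∈ D.Astar} => twoTop (D.gD ℤ) (D.dD ℤ) (u p.1) (w (D.γ q).1)).map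
            (Int.castRingHom ℂ) := by
        ext p q; simp only [Matrix.map_apply, Matrix.of_apply]; exact (D.cast_twoTop ℂ _ _).symm
      rw [hcast, ← RingHom.mapMatrix_apply, ← RingHom.map_det]
      intro h0
      rw [eq_intCast, Int.cast_eq_zero] at h0
      exact hB h0
    · rw [D.toSquareBlock_two ℂ hu, Matrix.det_transpose,
        det_inclusionMatrix (fun a : {a // D.rt a = 2} => w (D.β ⟨a.1, (D.rt_eq_two_iff a.1).mp a.2⟩).1)
          (fun a b hab => by
            have h1 := D.β.injective (Subtype.ext (hw hab))
            have h2 := congrArg Subtype.val h1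
            exact Subtype.ext h2)]
      exact one_ne_zero
    · haveI := D.subsingleton_fiber_three
      rw [Matrix.det_eq_elem_of_subsingleton _ ⟨i₁, hi₁⟩]
      simp only [Matrix.toSquareBlock_def, N_apply, Matrix.of_apply]
      have hi : u i₁ = ∅ := Finset.card_eq_zero.mp ((D.rt_eq_three_iff i₁).mp hi₁)
      have hj : w (D.κ i₁) = ∅ := Finset.card_eq_zero.mp ((D.ct_eq_three_iff _).mp ((D.ct_κ i₁).trans hi₁))
      rw [hi, hj, twoTop_empty_left, if_pos rfl]
      exact one_ne_zero
  have hN : (D.N ℂ).det ≠ 0 := by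
    rw [Matrix.BlockTriangular.det (D.blockTriangular_N ℂ hu hw)]
    exact Finset.prod_ne_zero_iff.mpr hblocks
  let N₀ : Matrix (Fin r) (Fin r) ℂ := Matrix.of fun i j => twoTop (D.gD ℂ) (D.dD ℂ) (u i) (w j)
  have hN' : D.N ℂ = N₀.submatrix id D.κ := rfl
  have hN₀ : N₀.det ≠ 0 := by
    intro h0; apply hN; rw [hN', Matrix.det_permute', h0, mul_zero]
  exact starDet_ne_zero_of_twoTop u w (D.gD ℂ) (D.dD ℂ) hN₀

/-- **… door level: `symbolicDet 2 ≠ 0`** for an injective lower pair with such a design. -/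
theorem symbolicDet_two_ne_zero_of_design (hu : Function.Injective u) (hw : Function.Injective w)
    (hlu : IsLowerSet (Set.range u)) (hlw : IsLowerSet (Set.range w))
    (hB : (Matrix.of fun p q : {i // i ∈ D.Astar} => twoTop (D.gD ℤ) (D.dD ℤ) (u p.1) (w (D.γ q).1)).det ≠ 0) :
    symbolicDet 2 h r u w ≠ 0 := by
  obtain ⟨g, d, hdet⟩ := D.starDet_ne_zero_of_design hu hw hB
  exact symbolicDet_two_ne_zero_of_starDet g d u w hu hw hlu hlw hdet

end TCDesign

end StarDoor

end

end Summit.ValiantsHypothesis.ValiantsHypothesis.Theorems.BarrierLever.AnchoredPeeling
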